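import Mathlib.Algebra.Ring.GeomSum
import Mathlib.Algebra.MonoidAlgebra.Basic
import Mathlib.Tactic.NoncommRing
import Literature.Algebra.Lie.FreeLieAlgebraGrading
import Literature.GroupTheory.CombinatorialGroupTheory.MagnusFiltration
import HarnessLib

/-!
# The truncated Magnus algebra of a free group: truncation, the regular action, the degree grading

Topic `Literature/GroupTheory/CombinatorialGroupTheory`. Algebraic groundwork for Magnus' representation of
the free group `F(X)` in the ring `ℤ⟨⟨X⟩⟩` of non-commutative power series truncated at degree `N`
(`Literature/GroupTheory/CombinatorialGroupTheory/FreeGroupMagnus.lean`; Magnus 1935, Magnus–Karrass–Solitar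
§5.5–5.7).  Let `𝒯 = ℤ[FreeMonoid X]` be the free associative ring on `X`, graded by word length (the unit
weight of `Literature.Algebra.Lie.tensorGrade`).  This file provides, exactly parallel to the weighted surface-group
version `Literature/Algebra/Lie/SurfaceMagnusAlgebra.lean`:

* the degree filtration `geW X n` (combinations of words of length `≥ n`), multiplicative (`mul_mem_geW`), and the
  light part `light X N` (length `≤ N`);
* the **truncation** `trunc X N : 𝒯 → 𝒯` and its calculus (`trunc_mul_trunc`, `sub_trunc_mem_geW`, …); the truncated
  module `M X N = light X N` with the **left-regular truncated action** `Lop X N : 𝒯 →+* End_ℤ(M)`,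
  `u ↦ (x ↦ trunc (u x))`, faithful on light elements (`eq_zero_of_Lop_eq_zero`);
* the finite grading `Gr X N` of `M` by length (an instance of `FiniteGrading` of
  `Literature/GroupTheory/CombinatorialGroupTheory/MagnusFiltration.lean`), the induced filtration of `End_ℤ(M)`
  (`Lop_mem_fil`, `Lop_isHomogeneous`) and the **leading terms of left multiplications**:
  `lead_k (Lop u) = Lop (tensorProj k u)` for light `u` (`lead_Lop`);
* unipotent units `1 + T`, `T ∈ Fil₁` (`oneAddUnit`).

Everything here is elementary and fully proved; there are no named facts.

## References

* W. Magnus, Beziehungen zwischen Gruppen und Idealen in einem speziellen Ring, Math. Ann. 111 (1935) 259–280.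
* W. Magnus, A. Karrass, D. Solitar, *Combinatorial Group Theory*, 2nd ed., Dover 1976, §5.5–5.7.
* J.-P. Serre, *Lie algebras and Lie groups*, LNM 1500, Part I, Ch. IV §6.
-/

noncomputable section

namespace Literature.GroupTheory.CombinatorialGroupTheory

namespace FreeMagnus

open Literature.Algebra.Lie MonoidAlgebra

variable (X : Type*) (N : ℕ)

/-- `𝒯 = ℤ[FreeMonoid X]`, the free associative ring on the alphabet `X`. [folklore] -/
abbrev T : Type _ := MonoidAlgebra ℤ (FreeMonoid X)

variable {X} in
/-- The length of a word (the unit weight of `Literature.Algebra.Lie.wordWeight`). [folklore] -/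
abbrev ω (w : FreeMonoid X) : ℕ := (wordWeight (fun _ : X => (1 : ℕ)) w).toAdd

variable {X} in
/-- The letter `e_x ∈ 𝒯` of `x ∈ X`. [folklore] -/
def e (x : X) : T X := MonoidAlgebra.single (FreeMonoid.of x) 1

/-! ## The degree filtration and truncation -/

/-- `geW n`: combinations of words of length `≥ n`. [folklore] -/
def geW (n : ℕ) : Submodule ℤ (T X) := MonoidAlgebra.supported ℤ ℤ {w | n ≤ ω w}

/-- `light N`: combinations of words of length `≤ N`. [folklore] -/
def light : Submodule ℤ (T X) := MonoidAlgebra.supported ℤ ℤ {w | ω w ≤ N}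

variable {X N}

/-- Membership in `geW n` via coefficients. [folklore] -/
theorem mem_geW_iff {n : ℕ} {a : T X} : a ∈ geW X n ↔ ∀ w, a.coeff w ≠ 0 → n ≤ ω w := by
  unfold geW; rw [MonoidAlgebra.mem_supported]
  exact ⟨fun h w hw => h (Finsupp.mem_support_iff.2 hw), fun h w hw => h w (Finsupp.mem_support_iff.1 hw)⟩

/-- Membership in `light N` via coefficients. [folklore] -/
theorem mem_light_iff {a : T X} : a ∈ light X N ↔ ∀ w, a.coeff w ≠ 0 → ω w ≤ N := by
  unfold light; rw [MonoidAlgebra.mem_supported]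
  exact ⟨fun h w hw => h (Finsupp.mem_support_iff.2 hw), fun h w hw => h w (Finsupp.mem_support_iff.1 hw)⟩

/-- `geW` decreases. [folklore] -/
theorem geW_antitone {m n : ℕ} (h : m ≤ n) : geW X n ≤ geW X m :=
  fun _ ha => mem_geW_iff.2 fun w hw => h.trans (mem_geW_iff.1 ha w hw)

/-- Everything has length `≥ 0`. [folklore] -/
theorem mem_geW_zero (a : T X) : a ∈ geW X 0 := mem_geW_iff.2 fun _ _ => Nat.zero_le _

/-- A word of length `≥ n` lies in `geW n`. [folklore] -/
theorem single_mem_geW {n : ℕ} {w : FreeMonoid X} (hw : n ≤ ω w) (c : ℤ) : single w c ∈ geW X n := by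
  refine mem_geW_iff.2 fun w' hw' => ?_
  rw [MonoidAlgebra.coeff_single] at hw'
  rw [Finset.mem_singleton.1 (Finsupp.support_single_subset (Finsupp.mem_support_iff.2 hw'))]
  exact hw

/-- The letter `e_x` has length `1`. [folklore] -/
theorem e_mem_geW (x : X) : e x ∈ geW X 1 := single_mem_geW (by simp [ω]) 1

/-- The letter `e_x` is homogeneous of length `1`. [folklore] -/
theorem e_mem_tensorGrade (x : X) : e x ∈ tensorGrade ℤ (fun _ : X => (1 : ℕ)) 1 :=
  single_of_mem_tensorGrade (fun _ : X => (1 : ℕ)) x 1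

/-- Pure length `n` implies length `≥ n`. [folklore] -/
theorem tensorGrade_le_geW (n : ℕ) : tensorGrade ℤ (fun _ : X => (1 : ℕ)) n ≤ geW X n :=
  fun _ ha => mem_geW_iff.2 fun w hw => le_of_eq (((mem_tensorGrade_iff.1 ha) w (Finsupp.mem_support_iff.2 hw)).symm)

/-- Pure length `n ≤ N` implies light. [folklore] -/
theorem tensorGrade_le_light {n : ℕ} (hn : n ≤ N) : tensorGrade ℤ (fun _ : X => (1 : ℕ)) n ≤ light X N :=
  fun _ ha => mem_light_iff.2 fun w hw => (le_of_eq ((mem_tensorGrade_iff.1 ha) w (Finsupp.mem_support_iff.2 hw))).trans hn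

/-- **Multiplicativity of the degree filtration**: `geW m · geW n ⊆ geW (m+n)`. [folklore] -/
theorem mul_mem_geW {m n : ℕ} {a b : T X} (ha : a ∈ geW X m) (hb : b ∈ geW X n) : a * b ∈ geW X (m + n) := by
  classical
  unfold geW at ha hb ⊢
  rw [MonoidAlgebra.mem_supported] at ha hb ⊢
  intro w hw
  obtain ⟨u, hu, v, hv, rfl⟩ := Finset.mem_mul.1 (MonoidAlgebra.support_coeff_mul_subset a b hw)
  change m + n ≤ ω (u * v)
  simp only [ω, map_mul, toAdd_mul]
  exact Nat.add_le_add (ha hu) (hb hv)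

/-- Powers climb the filtration: `a ∈ geW 1 ⟹ aᵐ ∈ geW m`. [folklore] -/
theorem pow_mem_geW {a : T X} (ha : a ∈ geW X 1) (m : ℕ) : a ^ m ∈ geW X m := by
  induction m with
  | zero => rw [pow_zero]; exact mem_geW_zero _
  | succ m ih => rw [pow_succ]; exact mul_mem_geW ih ha

variable (X N)

open Classical in
/-- The **truncation** at length `N`: keep the words of length `≤ N`. [folklore] -/
def trunc : T X →ₗ[ℤ] T X :=
  (MonoidAlgebra.coeffLinearEquiv ℤ).symm.toLinearMap ∘ₗ
    finsuppFilterLinear (fun w => ω w ≤ N) ∘ₗ (MonoidAlgebra.coeffLinearEquiv ℤ).toLinearMap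

variable {X N}

open Classical in
/-- Coefficients of the truncation. [folklore] -/
theorem coeff_trunc (a : T X) (w : FreeMonoid X) :
    (trunc X N a).coeff w = if ω w ≤ N then a.coeff w else 0 := by
  simp [trunc, Finsupp.filter_apply]

/-- The truncation is light. [folklore] -/
theorem trunc_mem_light (a : T X) : trunc X N a ∈ light X N := by
  refine mem_light_iff.2 fun w hw => ?_
  rw [coeff_trunc] at hw
  by_contra h; exact hw (if_neg h)

/-- Light elements are their own truncation. [folklore] -/
theorem trunc_of_mem_light {a : T X} (ha : a ∈ light X N) : trunc X N a = a := by
  refine MonoidAlgebra.coeff_injective (Finsupp.ext fun w => ?_)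
  rw [coeff_trunc]
  split_ifs with h
  · rfl
  · by_contra hne; exact h (mem_light_iff.1 ha w (Ne.symm hne))

/-- Heavy elements (length `> N`) truncate to zero. [folklore] -/
theorem trunc_of_mem_geW_succ {a : T X} (ha : a ∈ geW X (N + 1)) : trunc X N a = 0 := by
  refine MonoidAlgebra.coeff_injective (Finsupp.ext fun w => ?_)
  rw [coeff_trunc, MonoidAlgebra.coeff_zero, Finsupp.zero_apply]
  split_ifs with h
  · by_contra hne
    have := mem_geW_iff.1 ha w hne
    omega
  · rfl

/-- `a - trunc a` is heavy. [folklore] -/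
theorem sub_trunc_mem_geW (a : T X) : a - trunc X N a ∈ geW X (N + 1) := by
  refine mem_geW_iff.2 fun w hw => ?_
  rw [MonoidAlgebra.coeff_sub, Finsupp.sub_apply, coeff_trunc] at hw
  by_contra h
  rw [if_pos (by omega), sub_self] at hw
  exact hw rfl

/-- Truncation does not lower lengths: `a ∈ geW n ⟹ trunc a ∈ geW n`. [folklore] -/
theorem trunc_mem_geW {n : ℕ} {a : T X} (ha : a ∈ geW X n) : trunc X N a ∈ geW X n := by
  refine mem_geW_iff.2 fun w hw => ?_
  rw [coeff_trunc] at hw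
  split_ifs at hw with h
  · exact mem_geW_iff.1 ha w hw
  · exact absurd rfl hw

/-- Truncation preserves pure length. [folklore] -/
theorem trunc_mem_tensorGrade {n : ℕ} {a : T X} (ha : a ∈ tensorGrade ℤ (fun _ : X => (1 : ℕ)) n) :
    trunc X N a ∈ tensorGrade ℤ (fun _ : X => (1 : ℕ)) n := by
  rw [mem_tensorGrade_iff] at ha ⊢
  intro w hw
  rw [Finsupp.mem_support_iff, coeff_trunc] at hw
  split_ifs at hw with h
  · exact ha w (Finsupp.mem_support_iff.2 hw)
  · exact absurd rfl hw

/-- `1` is light. [folklore] -/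
theorem one_mem_light : (1 : T X) ∈ light X N := by
  rw [MonoidAlgebra.one_def]
  refine mem_light_iff.2 fun w hw => ?_
  rw [MonoidAlgebra.coeff_single] at hw
  rw [Finset.mem_singleton.1 (Finsupp.support_single_subset (Finsupp.mem_support_iff.2 hw))]
  simp [ω]

/-- Truncating a product after truncating a factor: `trunc (a · trunc b) = trunc (a b)`. [folklore] -/
theorem trunc_mul_trunc (a b : T X) : trunc X N (a * trunc X N b) = trunc X N (a * b) := by
  have h : a * b = a * trunc X N b + a * (b - trunc X N b) := by rw [← mul_add, add_sub_cancel]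
  rw [h, map_add, trunc_of_mem_geW_succ (N := N) (a := a * (b - trunc X N b)), add_zero]
  have := mul_mem_geW (mem_geW_zero a) (sub_trunc_mem_geW (N := N) b)
  rwa [zero_add] at this

/-- `trunc (trunc a · b) = trunc (a b)`. [folklore] -/
theorem trunc_trunc_mul (a b : T X) : trunc X N (trunc X N a * b) = trunc X N (a * b) := by
  have h : a * b = trunc X N a * b + (a - trunc X N a) * b := by rw [← add_mul, add_sub_cancel]
  rw [h, map_add, trunc_of_mem_geW_succ (N := N) (a := (a - trunc X N a) * b), add_zero]
  have := mul_mem_geW (sub_trunc_mem_geW (N := N) a) (mem_geW_zero b)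
  rwa [add_zero] at this

/-- A light element is the sum of its homogeneous components of length `≤ N`. [folklore] -/
theorem sum_tensorProj_of_mem_light {a : T X} (ha : a ∈ light X N) :
    ∑ i ∈ Finset.range (N + 1), tensorProj (fun _ : X => (1 : ℕ)) i a = a := by
  refine MonoidAlgebra.coeff_injective (Finsupp.ext fun w => ?_)
  rw [MonoidAlgebra.coeff_sum, Finsupp.finsetSum_apply]
  simp only [coeff_tensorProj]
  rw [Finset.sum_ite_eq]
  split_ifs with h
  · rfl
  · rw [Finset.mem_range, not_lt] at h
    by_contra hne
    have := mem_light_iff.1 ha w (Ne.symm hne)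
    change N + 1 ≤ ω w at h
    omega

/-! ## The truncated module `M = light N` and the action `Lop` -/

variable (X N)

/-- The truncated module `M = 𝒯_{≤ N}` (light elements). [folklore] -/
abbrev M : Type _ := ↥(light X N)

/-- Truncation as a map into `M`. [folklore] -/
def truncM : T X →ₗ[ℤ] M X N := LinearMap.codRestrict (light X N) (trunc X N) trunc_mem_light

/-- The **truncated left multiplication** `Lop u : x ↦ trunc (u x)` on `M`. [folklore] -/
def LopLin (u : T X) : Module.End ℤ (M X N) :=
  truncM X N ∘ₗ LinearMap.mulLeft ℤ u ∘ₗ (light X N).subtype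

/-- **`Lop` is a ring morphism `𝒯 → End_ℤ(M)`** (the truncated left-regular representation). [folklore] -/
def Lop : T X →+* Module.End ℤ (M X N) where
  toFun := LopLin X N
  map_one' := by
    refine LinearMap.ext fun x => Subtype.ext ?_
    change trunc X N (1 * x) = x
    rw [one_mul, trunc_of_mem_light x.2]
  map_mul' u v := by
    refine LinearMap.ext fun x => Subtype.ext ?_
    change trunc X N (u * v * x) = trunc X N (u * trunc X N (v * x))
    rw [trunc_mul_trunc, mul_assoc]
  map_zero' := by
    refine LinearMap.ext fun x => Subtype.ext ?_
    change trunc X N (0 * x) = 0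
    rw [zero_mul, map_zero]
  map_add' u v := by
    refine LinearMap.ext fun x => Subtype.ext ?_
    change trunc X N ((u + v) * x) = trunc X N (u * x) + trunc X N (v * x)
    rw [add_mul, map_add]

variable {X N}

/-- `trunc (u x)` is the value of `Lop u` at `x`. [folklore] -/
theorem trunc_mul_eq_coe_Lop (u : T X) (x : M X N) : trunc X N (u * x) = (Lop X N u x : T X) := rfl

/-- The unit vector `1 ∈ M`. [folklore] -/
def oneM : M X N := ⟨1, one_mem_light⟩

/-- The unit vector is `1`. [folklore] -/
@[simp] theorem coe_oneM : ((oneM : M X N) : T X) = 1 := rfl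

/-- `Lop u 1 = trunc u`. [folklore] -/
theorem coe_Lop_oneM (u : T X) : (Lop X N u (oneM : M X N) : T X) = trunc X N u := by
  rw [← trunc_mul_eq_coe_Lop, coe_oneM, mul_one]

/-- Heavy elements act by zero. [folklore] -/
theorem Lop_eq_zero_of_mem_geW_succ {u : T X} (hu : u ∈ geW X (N + 1)) : Lop X N u = 0 := by
  refine LinearMap.ext fun x => Subtype.ext ?_
  rw [← trunc_mul_eq_coe_Lop, LinearMap.zero_apply]
  have := mul_mem_geW hu (mem_geW_zero (x : T X))
  rw [add_zero] at this
  exact trunc_of_mem_geW_succ this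

/-- `Lop` only sees the truncation: `Lop (trunc u) = Lop u`. [folklore] -/
theorem Lop_trunc (u : T X) : Lop X N (trunc X N u) = Lop X N u := by
  have e : u = trunc X N u + (u - trunc X N u) := by abel
  conv_rhs => rw [e, map_add, Lop_eq_zero_of_mem_geW_succ (sub_trunc_mem_geW u), add_zero]

/-- **Faithfulness on light elements**: a light `u` acting by zero is zero. [folklore] -/
theorem eq_zero_of_Lop_eq_zero {u : T X} (hu : u ∈ light X N) (h : Lop X N u = 0) : u = 0 := by
  have := coe_Lop_oneM (N := N) u
  rw [h, LinearMap.zero_apply, trunc_of_mem_light hu] at this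
  exact this.symm

/-- Light elements with the same action are equal. [folklore] -/
theorem eq_of_Lop_eq {u v : T X} (hu : u ∈ light X N) (hv : v ∈ light X N) (h : Lop X N u = Lop X N v) : u = v := by
  rw [← sub_eq_zero]
  exact eq_zero_of_Lop_eq_zero (sub_mem hu hv) (by rw [map_sub, h, sub_self])

/-! ## The length grading of `M` -/

/-- Length projections preserve lightness. [folklore] -/
theorem tensorProj_mem_light {a : T X} (ha : a ∈ light X N) (i : ℕ) :
    tensorProj (fun _ : X => (1 : ℕ)) i a ∈ light X N := by
  refine mem_light_iff.2 fun w hw => ?_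
  rw [coeff_tensorProj] at hw
  split_ifs at hw with h
  · exact mem_light_iff.1 ha w hw
  · exact absurd rfl hw

variable (X N)

/-- The length-`i` projection on `M`. [folklore] -/
def projM (i : ℕ) : Module.End ℤ (M X N) :=
  (tensorProj (R := ℤ) (fun _ : X => (1 : ℕ)) i).restrict fun _ ha => tensorProj_mem_light ha i

/-- `projM i` computes `tensorProj i`. [folklore] -/
@[simp] theorem coe_projM (i : ℕ) (x : M X N) :
    ((projM X N i x : M X N) : T X) = tensorProj (fun _ : X => (1 : ℕ)) i (x : T X) := rfl

/-- **The finite grading of `M = 𝒯_{≤ N}` by length.** [folklore] -/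
def Gr : FiniteGrading ℤ (M X N) where
  bound := N
  proj := projM X N
  proj_mul_proj i j := by
    split_ifs with h
    · subst h
      refine LinearMap.ext fun x => Subtype.ext ?_
      simp only [Module.End.mul_apply, coe_projM]
      exact tensorProj_apply_of_mem_self (tensorProj_mem _ _ _)
    · refine LinearMap.ext fun x => Subtype.ext ?_
      simp only [Module.End.mul_apply, coe_projM, LinearMap.zero_apply, ZeroMemClass.coe_zero]
      exact tensorProj_apply_of_mem_ne (tensorProj_mem _ _ _) (Ne.symm h)
  proj_eq_zero_of_lt i hi := by
    refine LinearMap.ext fun x => Subtype.ext ?_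
    simp only [coe_projM, LinearMap.zero_apply, ZeroMemClass.coe_zero]
    refine MonoidAlgebra.coeff_injective (Finsupp.ext fun w => ?_)
    rw [coeff_tensorProj, MonoidAlgebra.coeff_zero, Finsupp.zero_apply]
    split_ifs with h
    · by_contra hne
      have := mem_light_iff.1 x.2 w hne
      change ω w = i at h
      omega
    · rfl
  sum_proj := by
    refine LinearMap.ext fun x => Subtype.ext ?_
    rw [LinearMap.sum_apply, Submodule.coe_sum, Module.End.one_apply]
    simp only [coe_projM]
    exact sum_tensorProj_of_mem_light x.2

variable {X N}

/-- The filtration pieces of the grading are the degree filtration: `x ∈ M_{≥ i} ↔ x ∈ geW i`. [folklore] -/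
theorem mem_ge_iff {i : ℕ} {x : M X N} : x ∈ (Gr X N).ge i ↔ (x : T X) ∈ geW X i := by
  rw [FiniteGrading.mem_ge_iff]
  constructor
  · intro h
    refine mem_geW_iff.2 fun w hw => ?_
    by_contra hlt
    rw [not_le] at hlt
    have h1 := congrArg (fun y : M X N => (y : T X).coeff w) (h (ω w) hlt)
    change (tensorProj (fun _ : X => (1 : ℕ)) (ω w) (x : T X)).coeff w = (0 : T X).coeff w at h1
    rw [coeff_tensorProj, if_pos rfl, MonoidAlgebra.coeff_zero, Finsupp.zero_apply] at h1
    exact hw h1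
  · intro h j hj
    refine Subtype.ext ?_
    change tensorProj (fun _ : X => (1 : ℕ)) j (x : T X) = 0
    refine MonoidAlgebra.coeff_injective (Finsupp.ext fun w => ?_)
    rw [coeff_tensorProj, MonoidAlgebra.coeff_zero, Finsupp.zero_apply]
    split_ifs with hw
    · by_contra hne
      have := mem_geW_iff.1 h w hne
      change ω w = j at hw
      omega
    · rfl

/-- Left multiplication by an element of length `≥ k` raises the filtration by `k`. [folklore] -/
theorem Lop_mem_fil {k : ℕ} {u : T X} (hu : u ∈ geW X k) : Lop X N u ∈ (Gr X N).fil k := by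
  refine (FiniteGrading.mem_fil_iff _).2 fun i x hx => ?_
  rw [mem_ge_iff] at hx ⊢
  rw [← trunc_mul_eq_coe_Lop]
  have := mul_mem_geW hu hx
  rw [add_comm] at this
  exact trunc_mem_geW this

/-- Left multiplication by an element of pure length `k` is homogeneous of degree `k`. [folklore] -/
theorem Lop_isHomogeneous {k : ℕ} {u : T X} (hu : u ∈ tensorGrade ℤ (fun _ : X => (1 : ℕ)) k) :
    (Gr X N).IsHomogeneous k (Lop X N u) := by
  intro i x
  refine Subtype.ext ?_
  change tensorProj (fun _ : X => (1 : ℕ)) (i + k) (trunc X N (u * tensorProj (fun _ : X => (1 : ℕ)) i (x : T X))) =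
    trunc X N (u * tensorProj (fun _ : X => (1 : ℕ)) i (x : T X))
  refine tensorProj_apply_of_mem_self (trunc_mem_tensorGrade ?_)
  have := mul_mem_tensorGrade hu (tensorProj_mem (R := ℤ) (fun _ : X => (1 : ℕ)) i (x : T X))
  rwa [add_comm] at this

/-- A homogeneous operator of degree `i` has no leading term in degrees `k ≠ i`. [folklore] -/
theorem lead_eq_zero_of_isHomogeneous_ne {i k : ℕ} {S : Module.End ℤ (M X N)} (hS : (Gr X N).IsHomogeneous i S)
    (hik : i ≠ k) : (Gr X N).lead k S = 0 := by
  refine LinearMap.ext fun x => ?_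
  rw [FiniteGrading.lead_apply, LinearMap.zero_apply]
  refine Finset.sum_eq_zero fun j _ => ?_
  rw [← hS j x, (Gr X N).proj_proj_of_ne (by omega)]

/-- **Leading terms of left multiplications**: `lead_k (Lop u) = Lop (tensorProj k u)` for light `u`. [folklore] -/
theorem lead_Lop (k : ℕ) {u : T X} (hu : u ∈ light X N) :
    (Gr X N).lead k (Lop X N u) = Lop X N (tensorProj (fun _ : X => (1 : ℕ)) k u) := by
  conv_lhs => rw [← sum_tensorProj_of_mem_light hu, map_sum, map_sum]
  have hterm : ∀ i, (Gr X N).lead k (Lop X N (tensorProj (fun _ : X => (1 : ℕ)) i u)) =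
      if i = k then Lop X N (tensorProj (fun _ : X => (1 : ℕ)) k u) else 0 := by
    intro i
    split_ifs with h
    · subst h
      exact (Gr X N).lead_eq_self (Lop_isHomogeneous (tensorProj_mem _ _ _))
    · exact lead_eq_zero_of_isHomogeneous_ne (Lop_isHomogeneous (tensorProj_mem _ _ _)) h
  simp only [hterm, Finset.sum_ite_eq']
  split_ifs with hk
  · rfl
  · rw [Finset.mem_range, not_lt] at hk
    have h0 : tensorProj (fun _ : X => (1 : ℕ)) k u = 0 := by
      refine MonoidAlgebra.coeff_injective (Finsupp.ext fun w => ?_)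
      rw [coeff_tensorProj, MonoidAlgebra.coeff_zero, Finsupp.zero_apply]
      split_ifs with h
      · by_contra hne
        have := mem_light_iff.1 hu w hne
        change ω w = k at h
        omega
      · rfl
    rw [h0, map_zero]

/-- Operators in `Fil_{N+1}` vanish (the grading is concentrated in degrees `≤ N`). [folklore] -/
theorem eq_zero_of_mem_fil_succ {S : Module.End ℤ (M X N)} (hS : S ∈ (Gr X N).fil (N + 1)) : S = 0 := by
  refine LinearMap.ext fun x => ?_
  have hx : x ∈ (Gr X N).ge 0 := fun j hj => absurd hj (Nat.not_lt_zero j)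
  have := hS 0 x hx
  exact (Gr X N).eq_zero_of_mem_ge (show (Gr X N).bound < 0 + (N + 1) by change N < 0 + (N + 1); omega) this

/-- Powers of an operator in `Fil₁` climb the filtration. [folklore] -/
theorem pow_mem_fil {S : Module.End ℤ (M X N)} (hS : S ∈ (Gr X N).fil 1) (m : ℕ) : S ^ m ∈ (Gr X N).fil m := by
  induction m with
  | zero => rw [pow_zero]; exact (Gr X N).one_mem_fil_zero
  | succ m ih => rw [pow_succ]; exact (Gr X N).mul_mem_fil ih hS

/-! ## Unipotent units -/

variable (X N)

/-- The unit `1 + S` for `S ∈ Fil₁` (inverse `∑_{m ≤ N} (-S)^m`, as `S^{N+1} = 0`). [folklore] -/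
def oneAddUnit (S : Module.End ℤ (M X N)) (hS : S ∈ (Gr X N).fil 1) : (Module.End ℤ (M X N))ˣ where
  val := 1 + S
  inv := ∑ m ∈ Finset.range (N + 1), (-S) ^ m
  val_inv := by
    have h := mul_neg_geom_sum (-S) (N + 1)
    rw [sub_neg_eq_add] at h
    rw [h, eq_zero_of_mem_fil_succ (pow_mem_fil (Submodule.neg_mem _ hS) (N + 1)), sub_zero]
  inv_val := by
    have h := geom_sum_mul_neg (-S) (N + 1)
    rw [sub_neg_eq_add] at h
    rw [h, eq_zero_of_mem_fil_succ (pow_mem_fil (Submodule.neg_mem _ hS) (N + 1)), sub_zero]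

variable {X N}

/-- The values of `oneAddUnit S` and of its inverse. [folklore] -/
theorem coe_oneAddUnit_pair (S : Module.End ℤ (M X N)) (hS : S ∈ (Gr X N).fil 1) :
    ((oneAddUnit X N S hS : (Module.End ℤ (M X N))ˣ) : Module.End ℤ (M X N)) = 1 + S ∧
    (((oneAddUnit X N S hS)⁻¹ : (Module.End ℤ (M X N))ˣ) : Module.End ℤ (M X N)) =
      ∑ m ∈ Finset.range (N + 1), (-S) ^ m := ⟨rfl, rfl⟩

/-- The inverse of `oneAddUnit S`, and `oneAddUnit S` itself, are congruent to `1` modulo `Fil₁`. [folklore] -/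
theorem oneAddUnit_inv_mem_pair (S : Module.End ℤ (M X N)) (hS : S ∈ (Gr X N).fil 1) :
    (((oneAddUnit X N S hS)⁻¹ : (Module.End ℤ (M X N))ˣ) : Module.End ℤ (M X N)) - 1 ∈ (Gr X N).fil 1 ∧
      ((oneAddUnit X N S hS : (Module.End ℤ (M X N))ˣ) : Module.End ℤ (M X N)) - 1 ∈ (Gr X N).fil 1 := by
  refine ⟨?_, by rw [(coe_oneAddUnit_pair S hS).1, add_sub_cancel_left]; exact hS⟩
  rw [(coe_oneAddUnit_pair S hS).2, Finset.sum_range_succ', pow_zero, add_sub_cancel_right]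
  refine Submodule.sum_mem _ fun m _ => ?_
  exact (Gr X N).fil_antitone (show 1 ≤ m + 1 by omega) (pow_mem_fil (Submodule.neg_mem _ hS) (m + 1))

end FreeMagnus

end Literature.GroupTheory.CombinatorialGroupTheory
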